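import Literature.AlgebraicGeometry.CossartPiltant200819.GoodResolutionOneBlowupQuasiExcellent2019
import Literature.AlgebraicGeometry.Resolution.EmbeddedResolutionExcellentSurfacesSequence
import Summits.ResolutionOfSingularities.ResolutionOfSingularities.Theorems.WeightedInvariantDatumToEmbeddedLift
import HarnessLib

/-!
# Embedded snc-ification of the support of an effective Cartier divisor of dimension ≤ 2 by ONE supported blowing up — any ambient dimension
# (crux `FInjectiveMacaulayfication` stmt-ResolutionOfSingularities-15315, chain w45a; task (C‴) piece (1))

[OURS · L1 W4.5a · res-L1-w45a-lead-1] Helper theorem toward the residual-class census (ThmD-≤3, THEOREM-D programme); NOT a door rung, NOT a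
statement of any manuscript; AI-written, weaker than expert review.  KNOWN assembly (Cossart–Jannsen–Saito 2020 Thm. 1.4) modulo ONE named fact
BY NAME, principalization-free sibling of `EmbeddedSncThreefolds.embeddedSncThreefolds_of` (p561818): when the closed set `D` is ALREADY the
support of an effective Cartier divisor `K` (e.g. the exceptional divisor `𝓛𝒪_T` of a blowing up, `IsBlowup.isEffectiveCartier`), CJS's
embedded resolution of `D ⊆ Z` (which only needs `dim D ≤ 2`, in ANY regular excellent `Z`) has total transform `X₁ ∪ B₁ = Supp (K𝒪_{Z₁})`,
again the support of an effective Cartier divisor (`IsEffectiveCartier.comap_of_isBlowup`), so the union is snc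
(`IsTransversalWith.isStrictNormalCrossingsDivisor_union`) — no principalization and no dimension hypothesis on `Z`.

* `embeddedSnc_of_cartierSupport (hCJS) (Z) (hZreg) (hZexc) (K) (hK : IsEffectiveCartier K) (hdim : dim (Supp K) ≤ 2)` — `∃ 𝓛 ≠ 0`,
  `Supp 𝓛 ⊆ Supp K`, ONE blowing up `ρ : Z′ → Z` along `𝓛`, `Z′` regular, `ρ⁻¹(Supp K)` a strict normal crossings divisor.
-/

-- single-problem summit: the doubled namespace component is forced
set_option linter.dupNamespace false
set_option autoImplicit false

noncomputable section

open CategoryTheory CategoryTheory.Limits AlgebraicGeometry TopologicalSpace IsLocalRing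
open Literature.AlgebraicGeometry.Resolution Literature.AlgebraicGeometry.CossartPiltant200819
open Scheme.IdealSheafData

namespace Summit.ResolutionOfSingularities.ResolutionOfSingularities.Theorems.FInjectiveMacaulayfication.EmbeddedSncCartier

universe u

/-- **Embedded snc-ification of the support of an effective Cartier divisor of dimension `≤ 2`, by ONE blowing up supported on it, in a
regular excellent integral Noetherian scheme of ANY dimension.**  For `Z` integral Noetherian regular excellent and `K` an effective Cartier
ideal sheaf on `Z` with `dim (Supp K) ≤ 2` there are `𝓛 ≠ 0` with `Supp 𝓛 ⊆ Supp K` and a blowing up `ρ : Z′ → Z` along `𝓛` with `Z′`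
regular and `ρ⁻¹(Supp K)` a strict normal crossings divisor — given Cossart–Jannsen–Saito 2020 Thm. 1.4 (`CossartJannsenSaito2020EmbeddedSequenceB`).
Proof: CJS on `D := Supp K` (`.embedded.of_isClosed`): `π : Z₁ → Z`, one blowing up along `Q` with `Supp Q ⊆ D`, `Z₁` regular,
`π⁻¹D = X₁ ∪ B₁`, `B₁` snc, `X₁` transversal to `B₁`; `X₁ ∪ B₁ = Supp (K𝒪_{Z₁})` with `K𝒪_{Z₁}` effective Cartier
(`IsEffectiveCartier.comap_of_isBlowup`), so the union is snc; `Q ≠ 0` since `Supp K ∌` the generic point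
(`DatumToEmbedded.Lift.ne_bot_of_isEffectiveCartier`, reused).
[OURS · L1 W4.5a helper; KNOWN assembly; cite: CossartJannsenSaito2020, Thm. 1.4, Cor. 1.5; CossartPiltant2019, §4.1 (v1 p. 50)] -/
theorem embeddedSnc_of_cartierSupport (hCJS : CossartJannsenSaito2020EmbeddedSequenceB.{u})
    (Z : Scheme.{u}) [IsIntegral Z] [IsNoetherian Z] (hZreg : Scheme.IsRegular Z) (hZexc : Scheme.IsExcellent Z)
    (K : Z.IdealSheafData) (hK : IsEffectiveCartier K) (hdim : topologicalKrullDim (K.support : Set Z) ≤ 2) :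
    ∃ (𝓛 : Z.IdealSheafData) (Z' : Scheme.{u}) (ρ : Z' ⟶ Z),
      𝓛 ≠ ⊥ ∧ 𝓛.support ≤ K.support ∧ IsBlowup ρ 𝓛 ∧ Scheme.IsRegular Z' ∧
        IsStrictNormalCrossingsDivisor Z' (ρ ⁻¹' (K.support : Set Z)) := by
  classical
  have hE : CossartJannsenSaito2020Embedded.{u} := hCJS.embedded
  set D : Set Z := (K.support : Set Z) with hDdef
  have hD : IsClosed D := K.support.isClosed
  have hKne : K ≠ ⊥ := DatumToEmbedded.Lift.ne_bot_of_isEffectiveCartier hK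
  have hgen : genericPoint Z ∉ D := not_mem_support_genericPoint hKne
  -- CJS: embedded resolution of `D ⊆ Z`
  obtain ⟨Z₁, π, X₁, B₁, hT, hZ₁reg, -, -, -, -, hB₁, htot, htr⟩ := hE.of_isClosed Z hZreg hZexc D hD hdim
  have hX₁c : IsClosed X₁ := hT.isClosed_transform hD
  obtain ⟨Q, hQ, hQD⟩ := hT.exists_isBlowup
  have hQne : Q ≠ ⊥ := by
    intro h0
    have hmem : genericPoint Z ∈ (Q.support : Set Z) := by rw [h0, support_bot]; trivial
    exact hgen (hQD hmem)
  -- `X₁ ∪ B₁ = π⁻¹ D = Supp (K𝒪_{Z₁})` is the support of an effective Cartier divisor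
  have hcart₁ : IsEffectiveCartier (K.comap π) := IsEffectiveCartier.comap_of_isBlowup hQ hK
  have hcl : (⟨closure (X₁ ∪ B₁), isClosed_closure⟩ : Closeds Z₁) = (K.comap π).support := by
    apply Closeds.ext
    change closure (X₁ ∪ B₁) = ((K.comap π).support : Set Z₁)
    rw [(hX₁c.union hB₁.isClosed).closure_eq, support_comap, Closeds.coe_preimage, ← htot, hDdef]
  have hsnc : IsStrictNormalCrossingsDivisor Z₁ (X₁ ∪ B₁) := by
    refine htr.isStrictNormalCrossingsDivisor_union hB₁ hX₁c fun x _ => ?_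
    obtain ⟨t, ht, hst⟩ := hcart₁.exists_stalkIdeal_eq_span x
    refine ⟨t, nonZeroDivisors.ne_zero ht, ?_⟩
    rw [hcl, vanishingIdeal_support, stalkIdeal_radical, hst]
  exact ⟨Q, Z₁, π, hQne, hQD, hQ, hZ₁reg, htot ▸ hsnc⟩

end Summit.ResolutionOfSingularities.ResolutionOfSingularities.Theorems.FInjectiveMacaulayfication.EmbeddedSncCartier

end
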